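import Literature.IUT.HodgeArakelov.LabelClassesOfCuspsCor24iiAssemblyOfCoverModelInterR2
import Literature.IUT.HodgeArakelov.StableCurveAgreementOfSpecialFibre
import Literature.IUT.HodgeArakelov.StableCurveAgreementInertiaOfPiV
import HarnessLib

/-!
# [IUTchII] Cor 2.4 (ii)(iii)′ at the genuine pair `ofPiCHat ↔ ofSpecialFibre(X̲_v)`: the AGREEMENT OF RECORD's `Π^±_v`-cuspidal groups
# ARE the tempered cusp family, so the node holds at the SAME datum as Cor 2.4 (i) — non-vacuously

S. Mochizuki, *Inter-universal Teichmüller Theory II*, kurims manuscript (Dec. 2020), §2: Cor. 2.4 (ii)(a) p. 70, Def. 2.3 (i)(ii) pp. 67–68;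
*Inter-universal Teichmüller Theory I*, §2 p. 47 («a representative inertia group `I_x ⊆ Δ^tp_X`»); [SemiAnbd] §6 p. 71 («`I_y = H ∩ g I_x g⁻¹`»).
[cite: Mochizuki2012, II Cor 2.4 (ii) p.70; II Def 2.3 (i)(ii) pp.67–68] [cite: MochizukiSemiAnbd2006, §6 p.71]
abc-iut cell, layer L6, node **IUTchII:Cor2.4(ii)**; seat abc-iut-w6-d069 (gen 2).  PROOF-ONLY (0 `def`); sequel BY NAME to this seat's
p446260 (`cor24_ii_iii'_ofCoverModel_of_levels_of_members`, `hint_of_levels_of_members`), abc-iut-w5-d132's agreement of record at the genuine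
pair (`exists_stableCurveAgreement_ofPiCHat_ofSpecialFibre`, p433029 — consumed through its OUTPUT SHAPE: any `Cu`, `A` with the `hA` clause),
abc-iut-L6-t19's bookkeeping (`StableCurveAgreement.emb_mem_iff_of_map_eq`, `mem_conj_inertiaTp_ofSpecialFibre_iff`, p440804), abc-iut-L6-t7's
`TemperedCurve.ofOpenSubgroup` (`mem_decompOfOpenAt`, `repOfOpen`) and abc-iut-L6-t19's `ofPiCHat = ofCoverModel _ … toPiCHat …` (rfl).

CONTENT.
* §1 `mem_cuspFamily_iff_ofCoverModel` — membership of `ι(inclX u)` (`u ∈ Π^tp_{X̲}`) in the member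
  `ι(inclX s)·ι((inclX g_y·inclX I_x·inclX g_y⁻¹) ∩ inclX Π^tp_{X̲})·ι(inclX s)⁻¹`: iff `g_y⁻¹ (s⁻¹ u s) g_y ∈ I_x` (pure bookkeeping, `ι`, `inclX` injective);
* §2 **`members_of_specialFibreAgreement`** — for ANY `Cu`, `A : StableCurveAgreement (ofPiCHat …) Cu (ofSpecialFibre X̲_v …)` with
  `A.eHat ∘ emb = ιX ∘ plainIso` (the clause p433029 delivers): every `Cu`-cuspidal `I₀` of `Π^±_v` IS a member of the tempered cusp family —
  with `x :=` the cusp of `X` under the cusp `y` of `X̲_v`, `g := inclX (repOfOpen y)`, `t := toPiCHat (inclX s)` — i.e. the binder `hpm` of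
  p446260 HOLDS for the agreement of record;
* §3 **`cor24_ii_iii'_ofPiCHat_of_specialFibreAgreement`** — hence the node's typed statement `Cor24_ii_iii' (ofPiCHat …) Cu H` for every such
  levels-keyed `(Cu, A, hA, hlev)` (EXACTLY the output of p433029), modulo ⟨node Cor. 2.4 (i) at the same datum (`h24i`); (S) `hsurj`; (E) `hcap`;
  F-1704 `habs`; F-1708 `hcomm`; F-3213 R2 at `N = 2` (`hR2`)⟩ — the same genuine datum at which Cor. 2.4 (i) is discharged
  (`cor24_i'_ofPiCHat_of_graphTower_comap`, p440067), and NON-VACUOUS (`isCuspidalInertia_piV_inf_of_levels`, p446260, with §2); plus the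
  `hYdd`-only form `cuspDecomp_one_le_map_YddL_ofPiCHat_of_specialFibreAgreement` for the landed closers.

HONEST LIMITS: every Cor-2.4 / [SemiAnbd] / [EtTh] input is a named HYPOTHESIS; the special-fibre DATA of `X̲_v`, `hDopen`, L02 `hZ`, `hN` stay
quantified exactly as in p433029; nothing of the series is asserted; no side is taken on [IUTchIII] Cor. 3.12; typed ≠ proved.
-/

noncomputable section

namespace Literature.IUT.HodgeArakelov

open Literature.AnabelianGeometry.EtaleTheta Literature.AnabelianGeometry.SemiGraphs Literature.IUT.HodgeTheaters
open scoped Pointwise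

namespace PlusMinusTower

section Member

variable {p : ℕ} [Fact p.Prime] {M : MuTwoSetting p} {l : ℕ}
  {Q : Type} [Group Q] [TopologicalSpace Q] (ι : M.GtpC →ₜ* Q)

/-- In a group, `aug (a⁻¹ * b * a) = 1 ↔ aug b = 1` for a homomorphism `aug`. [folklore] -/
private theorem map_conj_eq_one_iff {G G' : Type*} [Group G] [Group G'] (f : G →* G') (a b : G) :
    f (a⁻¹ * b * a) = 1 ↔ f b = 1 := by
  constructor
  · intro h
    have hb : f b = f a * f (a⁻¹ * b * a) * (f a)⁻¹ := by
      rw [map_mul, map_mul, map_inv]; group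
    rw [hb, h, mul_one, mul_inv_cancel]
  · intro h
    rw [map_mul, map_mul, map_inv, h, mul_one, inv_mul_cancel]

/-- **§1. Membership in a member of the tempered cusp family** (bookkeeping; `ι`, `inclX` injective): for `u, s ∈ Π^tp_{X̲}`, a cusp `x` of `X`
and `g ∈ Π^tp_X`, `ι(inclX u) ∈ ι(inclX s)·ι((inclX g·inclX I_x·inclX g⁻¹) ∩ inclX Π^tp_{X̲})·ι(inclX s)⁻¹ ↔ g⁻¹ (s⁻¹ u s) g ∈ I_x`.
[claim: Mochizuki2012, status: disputed] (IUTchII §2 Def 2.3 (ii), kurims p.68) -/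
theorem mem_cuspFamily_iff_ofCoverModel (hinj : Function.Injective ι) (x : M.Pt) (g : M.PiTemp) (u s : M.GtpXu l) :
    ι (M.inclX (u : M.PiTemp)) ∈ (MulAut.conj (ι (M.inclX (s : M.PiTemp))) •
        (((MulAut.conj (M.inclX g) • (M.toTemperedCurve.inertia x).map M.inclX) ⊓ (M.GtpXu l).map M.inclX).map
          ι.toMonoidHom : Subgroup Q)) ↔
      g⁻¹ * ((s⁻¹ * u * s : M.GtpXu l) : M.PiTemp) * g ∈ M.toTemperedCurve.inertia x := by
  have hinj' : Function.Injective ι.toMonoidHom := hinj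
  rw [Subgroup.mem_pointwise_smul_iff_inv_smul_mem, MulAut.smul_def, MulAut.conj_inv_apply]
  have h1 : (ι (M.inclX (s : M.PiTemp)))⁻¹ * ι (M.inclX (u : M.PiTemp)) * ι (M.inclX (s : M.PiTemp)) =
      ι.toMonoidHom (M.inclX ((s⁻¹ * u * s : M.GtpXu l) : M.PiTemp)) := by
    simp only [map_mul, map_inv, Subgroup.coe_mul, Subgroup.coe_inv]; rfl
  rw [h1, Subgroup.mem_map_iff_mem hinj', Subgroup.mem_inf]
  have hmemX : M.inclX ((s⁻¹ * u * s : M.GtpXu l) : M.PiTemp) ∈ (M.GtpXu l).map M.inclX :=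
    ⟨((s⁻¹ * u * s : M.GtpXu l) : M.PiTemp), (s⁻¹ * u * s).2, rfl⟩
  rw [and_iff_left hmemX, Subgroup.mem_pointwise_smul_iff_inv_smul_mem, MulAut.smul_def, MulAut.conj_inv_apply,
    ← map_inv, ← map_mul, ← map_mul, Subgroup.mem_map_iff_mem M.injective_inclX]

end Member

variable {p : ℕ} [Fact p.Prime] {M : MuTwoSetting p} (e : M.CLevelData)
  {E : M.toThetaSetting.EtaleThetaData} {l : ℕ} (C : E.DoubleUnderline l) {N : ℕ+}
  (μ : M.toThetaSetting.CyclotomeMod l N) (hC : M.toThetaSetting.Compat) (hS : M.toThetaSetting.Sec2Hyps)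
  (hl : l.Prime) (hp2 : p ≠ 2) (hpl : p ≠ l) (hζ : ∃ ζ : M.toThetaSetting.K, IsPrimitiveRoot ζ (4 * l))
  {η : (C.thetaEnvData μ hC hS).PiYdd → MuN p N} (hη : η ∈ (C.thetaEnvData μ hC hS).thetaCocycles)
  (hZ : Thm16Sub.KerToZIsCompactlyGenerated M.toThetaSetting) (hN : (C.Huu.subgroupOf (M.GtpXu l)).Normal)
  {P : TopGroup.{0}} (T : TemperedCoverings (BadPlaceSetting.ofUnderline C μ hC hS hl hp2 hpl hζ hη) P)

/-- Elements of `Π^±_v` of the tower of record are `emb w`, `w ∈ T.Xplain`. [claim: Mochizuki2012, status: disputed]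
(IUTchII §2 Def 2.3 (i), kurims p.67) -/
theorem exists_emb_eq_of_mem_piPM_ofPiCHat {z : (ofPiCHat e C μ hC hS hl hp2 hpl hζ hη hZ hN T).Corhat}
    (hz : z ∈ (ofPiCHat e C μ hC hS hl hp2 hpl hζ hη hZ hN T).piPM) :
    ∃ w : T.Xplain, (ofPiCHat e C μ hC hS hl hp2 hpl hζ hη hZ hN T).emb w = z := by
  have hz' : z ∈ ((M.GtpXu l).map M.inclX).map e.toPiCHat.toMonoidHom := by
    rw [← piPM_ofCoverModel]; exact hz
  obtain ⟨_, ⟨u, hu, rfl⟩, rfl⟩ := hz'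
  refine ⟨T.plainIso.symm ⟨u, hu⟩, ?_⟩
  rw [(ofPiCHat_fields e C μ hC hS hl hp2 hpl hζ hη hZ hN T).2.2.2.2.1]
  change e.toPiCHat (M.inclX (T.plainIso (T.plainIso.symm ⟨u, hu⟩)).1) = _
  rw [ContinuousMulEquiv.apply_symm_apply]
  rfl

section Agreement

variable [(M.GtpXu l).FiniteIndex] [FiniteDimensional ℚ_[p] M.K]
  (hDopen : ∀ (x : M.toTemperedCurve.Pt) (g : M.toTemperedCurve.PiTemp),
    IsOpen (M.toTemperedCurve.aug '' ((M.toTemperedCurve.decompOfOpenAt (M.GtpXu l) x g).map (M.GtpXu l).subtype :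
      Set M.toTemperedCurve.PiTemp)))
  (d : (M.toTemperedCurve.ofOpenSubgroup (M.GtpXu l) (M.toThetaSetting.isOpen_GtpXu l) M.K (range_aug_GtpXu_eq_GK C) hDopen).GroupLevelData)
  (Sf : SpecialFibreData ((M.toTemperedCurve.ofOpenSubgroup (M.GtpXu l) (M.toThetaSetting.isOpen_GtpXu l) M.K (range_aug_GtpXu_eq_GK C) hDopen).toTemperedArithmeticGroup d))
  (h36 : Sf.Gc.Prop36Hypotheses) (Sigma SigmaHat : Set ℕ) (hsub : Sigma ⊆ SigmaHat) (hne : Sigma.Nonempty)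
  (hprime : ∀ q ∈ SigmaHat, q.Prime) (hp : p ∉ Sigma) (TpH : Subgroup Sf.chart.G)
  (HatH : Subgroup (TemperedGraphGroupData.exists_completion_of_prop36 Sf.Gc h36 Sf.chart).choose)
  (hle : TpH.map (TemperedGraphGroupData.exists_completion_of_prop36 Sf.Gc h36 Sf.chart).choose_spec.choose.toMonoidHom ≤ HatH)
  (cuspMeetsH : {x : (M.toTemperedCurve.ofOpenSubgroup (M.GtpXu l) (M.toThetaSetting.isOpen_GtpXu l) M.K (range_aug_GtpXu_eq_GK C) hDopen).Pt // (M.toTemperedCurve.ofOpenSubgroup (M.GtpXu l) (M.toThetaSetting.isOpen_GtpXu l) M.K (range_aug_GtpXu_eq_GK C) hDopen).IsCusp x} → Prop)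
  (Cu : CuspidalInertiaData (ofPiCHat e C μ hC hS hl hp2 hpl hζ hη hZ hN T))
  (A : StableCurveAgreement (ofPiCHat e C μ hC hS hl hp2 hpl hζ hη hZ hN T) Cu
    (StableCurveTemperedData.ofSpecialFibre (M.toTemperedCurve.ofOpenSubgroup (M.GtpXu l) (M.toThetaSetting.isOpen_GtpXu l) M.K (range_aug_GtpXu_eq_GK C) hDopen) d Sf h36 Sigma SigmaHat hsub hne hprime hp TpH HatH hle cuspMeetsH))
  (hA : ∀ x : T.Xplain,
    A.eHat ⟨(ofPiCHat e C μ hC hS hl hp2 hpl hζ hη hZ hN T).emb x, (ofPiCHat e C μ hC hS hl hp2 hpl hζ hη hZ hN T).emb_le_pmHat ⟨x, rfl⟩⟩ =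
      (StableCurveTemperedData.ofSpecialFibre (M.toTemperedCurve.ofOpenSubgroup (M.GtpXu l) (M.toThetaSetting.isOpen_GtpXu l) M.K (range_aug_GtpXu_eq_GK C) hDopen) d Sf h36 Sigma SigmaHat hsub hne hprime hp TpH HatH hle cuspMeetsH).ιX (T.plainIso x))

include hA in
/-- **§2. The `Π^±_v`-cuspidal groups of the AGREEMENT OF RECORD are members of the tempered cusp family** (the binder `hpm` of p446260
HOLDS for p433029's output): if `Cu.IsCuspidalInertia Π^±_v I₀` then `I₀ = toPiCHat(inclX s)·toPiCHat((inclX g_y·inclX I_x·inclX g_y⁻¹) ∩ inclX Π^tp_{X̲})·toPiCHat(inclX s)⁻¹`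
with `y` the cusp of `X̲_v` and `s ∈ Π^tp_{X̲_v}` given by `A.inertia_iff`, `x` the cusp of `X` under `y`, `g_y := repOfOpen y` ([SemiAnbd] §6 «`I_y = H ∩ g I_x g⁻¹`»).
PROVED (both sides lie in `Π^±_v = emb(T.Xplain)`, and on `emb w` the two memberships read `g_y⁻¹ (s⁻¹ w s) g_y ∈ I_x` —
`emb_mem_iff_of_map_eq` + `mem_conj_inertiaTp_ofSpecialFibre_iff` + `mem_decompOfOpenAt` on one side, `mem_cuspFamily_iff_ofCoverModel` on the other).
[claim: Mochizuki2012, status: disputed] (IUTchII §2 Def 2.3 (i)(ii), kurims pp.67–68) -/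
theorem members_of_specialFibreAgreement :
    ∀ I₀ : Subgroup (ofPiCHat e C μ hC hS hl hp2 hpl hζ hη hZ hN T).Corhat,
      Cu.IsCuspidalInertia (ofPiCHat e C μ hC hS hl hp2 hpl hζ hη hZ hN T).piPM I₀ →
        ∃ i : {x : M.Pt // M.IsCusp x} × M.GtpC,
          ∃ t ∈ (ofPiCHat e C μ hC hS hl hp2 hpl hζ hη hZ hN T).piPM,
            I₀ = (MulAut.conj t •
              (((MulAut.conj i.2 • (M.toTemperedCurve.inertia i.1.1).map M.inclX) ⊓ (M.GtpXu l).map M.inclX).map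
                e.toPiCHat.toMonoidHom :
                Subgroup (ofPiCHat e C μ hC hS hl hp2 hpl hζ hη hZ hN T).Corhat)) := by
  intro I₀ hI₀
  obtain ⟨hle0, y, s, hEq⟩ := (A.inertia_iff I₀).mp hI₀
  -- the member: cusp `x := y.1.1` of `X` under `y`, `g := inclX g_y` (`g_y := repOfOpen y`), `t := toPiCHat (inclX s)`
  have ht : e.toPiCHat (M.inclX s.1) ∈ (ofPiCHat e C μ hC hS hl hp2 hpl hζ hη hZ hN T).piPM := by
    have h : e.toPiCHat (M.inclX s.1) ∈ ((M.GtpXu l).map M.inclX).map e.toPiCHat.toMonoidHom :=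
      ⟨M.inclX s.1, ⟨s.1, s.2, rfl⟩, rfl⟩
    rw [← piPM_ofCoverModel] at h; exact h
  refine ⟨⟨⟨y.1.1, y.2⟩, M.inclX (M.toTemperedCurve.repOfOpen (M.GtpXu l) y.1)⟩, e.toPiCHat (M.inclX s.1), ht, ?_⟩
  -- on `emb w`, membership on either side reads `g_y⁻¹ (s⁻¹ w s) g_y ∈ I_x`
  have key : ∀ w : T.Xplain, (ofPiCHat e C μ hC hS hl hp2 hpl hζ hη hZ hN T).emb w ∈ I₀ ↔
      (ofPiCHat e C μ hC hS hl hp2 hpl hζ hη hZ hN T).emb w ∈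
        (@MulAut.conj (ofPiCHat e C μ hC hS hl hp2 hpl hζ hη hZ hN T).Corhat _ (e.toPiCHat (M.inclX s.1)) •
        (((MulAut.conj (M.inclX (M.toTemperedCurve.repOfOpen (M.GtpXu l) y.1)) •
            (M.toTemperedCurve.inertia y.1.1).map M.inclX) ⊓ (M.GtpXu l).map M.inclX).map
          e.toPiCHat.toMonoidHom : Subgroup (ofPiCHat e C μ hC hS hl hp2 hpl hζ hη hZ hN T).Corhat)) := by
    intro w
    refine (A.emb_mem_iff_of_map_eq (fun w => T.plainIso w) hA hEq w).trans ?_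
    refine (mem_conj_inertiaTp_ofSpecialFibre_iff _ d Sf h36 Sigma SigmaHat hsub hne hprime hp TpH HatH hle
      cuspMeetsH y s (T.plainIso w)).trans ?_
    refine Iff.trans ?_ (mem_cuspFamily_iff_ofCoverModel e.toPiCHat e.toPiCHat_injective y.1.1
      (M.toTemperedCurve.repOfOpen (M.GtpXu l) y.1) (T.plainIso w) s).symm
    -- `D_y = H ∩ g_y D_x g_y⁻¹` read in `H`, `aug` of `X̲_v` = `aug` of `X`; `I_x = D_x ∩ Ker(aug)`
    rw [TemperedCurve.inertia, Subgroup.mem_inf, TemperedCurve.DeltaTemp, MonoidHom.mem_ker, map_conj_eq_one_iff]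
    refine and_congr ?_ ?_
    · exact Iff.trans (M.toTemperedCurve.mem_decompOfOpenAt (M.GtpXu l)) (by rw [inv_inv]; exact Iff.rfl)
    · exact (map_conj_eq_one_iff M.toTemperedCurve.aug.toMonoidHom s.1 (T.plainIso w).1).symm
  -- both sides lie in `Π^±_v = emb(T.Xplain)`
  have hleM := cuspFamily_le_piPM_ofCoverModel e C μ hC hS hl hp2 hpl hζ hη e.toPiCHat e.isProfiniteCompletion_toPiCHat
    e.toPiCHat_injective e.piCData.aug.toMonoidHom (fun g => e.piCData_aug_apply g) e.piCData.range_aug hZ hN T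
    ⟨⟨y.1.1, y.2⟩, M.inclX (M.toTemperedCurve.repOfOpen (M.GtpXu l) y.1)⟩ ht
  ext z
  constructor
  · intro hz
    obtain ⟨w, rfl⟩ := exists_emb_eq_of_mem_piPM_ofPiCHat e C μ hC hS hl hp2 hpl hζ hη hZ hN T (hle0 hz)
    exact (key w).mp hz
  · intro hz
    obtain ⟨w, rfl⟩ := exists_emb_eq_of_mem_piPM_ofPiCHat e C μ hC hS hl hp2 hpl hζ hη hZ hN T (hleM hz)
    exact (key w).mpr hz

include hA in
/-- **§3a. (a.2) — the closers' binder `hYdd` — AT THE AGREEMENT OF RECORD** (`ofPiCHat ↔ ofSpecialFibre(X̲_v)`, p433029's output shape: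
`Cu`, `A`, `hA`, and the levels clause `hlev`), modulo ⟨F-1704 `habs`; F-1708 `hcomm`; F-3213 R2 at `N = 2` `hR2`⟩.  PROVED
(p446260 `…_of_levels_of_members` with `hpm := members_of_specialFibreAgreement`). [claim: Mochizuki2012, status: disputed]
(IUTchII §2 Cor 2.4 (ii)(a) p.70) -/
theorem cuspDecomp_one_le_map_YddL_ofPiCHat_of_specialFibreAgreement
    (hlev : ∀ Q' I : Subgroup (ofPiCHat e C μ hC hS hl hp2 hpl hζ hη hZ hN T).Corhat,
      Cu.IsCuspidalInertia Q' I ↔ I ≤ Q' ∧ ∃ I₀, Cu.IsCuspidalInertia (ofPiCHat e C μ hC hS hl hp2 hpl hζ hη hZ hN T).piPM I₀ ∧ I = I₀ ⊓ Q')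
    (habs : M.toTemperedCurve.IsoPreservesCuspidalDecomp M.toTemperedCurve)
    (hcomm : M.toTemperedCurve.DecompEqCommensuratorOfOpenInertia)
    (hR2 : Thm16Sub.GtpYNFromCusp M.toThetaSetting 2) (H : Subgroup P) :
    ∀ I : Subgroup (ofPiCHat e C μ hC hS hl hp2 hpl hζ hη hZ hN T).Corhat,
      Cu.IsCuspidalInertia (ofPiCHat e C μ hC hS hl hp2 hpl hζ hη hZ hN T).piV I → I ≤ (ofPiCHat e C μ hC hS hl hp2 hpl hζ hη hZ hN T).deltaBox H →
        (ofPiCHat e C μ hC hS hl hp2 hpl hζ hη hZ hN T).cuspDecomp I 1 ≤ (T.YddL).map ((ofPiCHat e C μ hC hS hl hp2 hpl hζ hη hZ hN T).emb.comp T.incl) :=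
  cuspDecomp_one_le_map_YddL_ofCoverModel_of_levels_of_members e C μ hC hS hl hp2 hpl hζ hη e.toPiCHat e.isProfiniteCompletion_toPiCHat e.toPiCHat_injective e.piCData.aug.toMonoidHom (fun g => e.piCData_aug_apply g) e.piCData.range_aug hZ hN T Cu hlev
    (members_of_specialFibreAgreement e C μ hC hS hl hp2 hpl hζ hη hZ hN T hDopen d Sf h36 Sigma SigmaHat hsub hne hprime hp
      TpH HatH hle cuspMeetsH Cu A hA) habs hcomm hR2 H

include hA in
/-- **§3b. IUTchII:Cor2.4(ii)(iii)′ AT THE AGREEMENT OF RECORD** — the typed node statement `Cor24_ii_iii' (ofPiCHat …) Cu H` for p433029's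
output `(Cu, A, hA, hlev)`, i.e. at the SAME genuine datum at which Cor. 2.4 (i) is discharged (`cor24_i'_ofPiCHat_of_graphTower_comap`,
p440067), modulo ⟨node Cor. 2.4 (i) at this datum (`h24i`); (S) `hsurj`; (E) `hcap`; F-1704 `habs`; F-1708 `hcomm`; F-3213 R2 at `N = 2` `hR2`⟩.
PROVED.  Non-vacuous: the `Π_v`-family of `Cu` contains the trace of every `Π^±_v`-cuspidal group (`isCuspidalInertia_piV_inf_of_levels`, p446260).
[claim: Mochizuki2012, status: disputed] (IUTchII §2 Cor 2.4 (ii) p.70) -/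
theorem cor24_ii_iii'_ofPiCHat_of_specialFibreAgreement
    (hlev : ∀ Q' I : Subgroup (ofPiCHat e C μ hC hS hl hp2 hpl hζ hη hZ hN T).Corhat,
      Cu.IsCuspidalInertia Q' I ↔ I ≤ Q' ∧ ∃ I₀, Cu.IsCuspidalInertia (ofPiCHat e C μ hC hS hl hp2 hpl hζ hη hZ hN T).piPM I₀ ∧ I = I₀ ⊓ Q')
    (H : Subgroup P)
    (h24i : ∀ I : Subgroup (ofPiCHat e C μ hC hS hl hp2 hpl hζ hη hZ hN T).Corhat,
      Cu.IsCuspidalInertia (ofPiCHat e C μ hC hS hl hp2 hpl hζ hη hZ hN T).piV I → I ≤ (ofPiCHat e C μ hC hS hl hp2 hpl hζ hη hZ hN T).deltaBox H →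
        Literature.IUT.HodgeArakelov.Cor24_i (ofPiCHat e C μ hC hS hl hp2 hpl hζ hη hZ hN T) Cu H I)
    (hsurj : ∀ n : (ofPiCHat e C μ hC hS hl hp2 hpl hζ hη hZ hN T).Corhat, n ∈ (ofPiCHat e C μ hC hS hl hp2 hpl hζ hη hZ hN T).piV →
      ∃ m : (ofPiCHat e C μ hC hS hl hp2 hpl hζ hη hZ hN T).Corhat, m ∈ (ofPiCHat e C μ hC hS hl hp2 hpl hζ hη hZ hN T).pmBox H ∧ m⁻¹ * n ∈ (ofPiCHat e C μ hC hS hl hp2 hpl hζ hη hZ hN T).aug.ker)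
    (hcap : (ofPiCHat e C μ hC hS hl hp2 hpl hζ hη hZ hN T).pmBox H ⊓ (ofPiCHat e C μ hC hS hl hp2 hpl hζ hη hZ hN T).piV ≤ (ofPiCHat e C μ hC hS hl hp2 hpl hζ hη hZ hN T).box H)
    (habs : M.toTemperedCurve.IsoPreservesCuspidalDecomp M.toTemperedCurve)
    (hcomm : M.toTemperedCurve.DecompEqCommensuratorOfOpenInertia)
    (hR2 : Thm16Sub.GtpYNFromCusp M.toThetaSetting 2) :
    Literature.IUT.HodgeArakelov.Cor24_ii_iii' (ofPiCHat e C μ hC hS hl hp2 hpl hζ hη hZ hN T) Cu H :=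
  cor24_ii_iii'_ofCoverModel_of_levels_of_members e C μ hC hS hl hp2 hpl hζ hη e.toPiCHat e.isProfiniteCompletion_toPiCHat e.toPiCHat_injective e.piCData.aug.toMonoidHom (fun g => e.piCData_aug_apply g) e.piCData.range_aug hZ hN T Cu hlev
    (members_of_specialFibreAgreement e C μ hC hS hl hp2 hpl hζ hη hZ hN T hDopen d Sf h36 Sigma SigmaHat hsub hne hprime hp
      TpH HatH hle cuspMeetsH Cu A hA) H h24i hsurj hcap habs hcomm hR2

omit [(M.GtpXu l).FiniteIndex] [FiniteDimensional ℚ_[p] M.K] in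
/-- **Non-vacuity at the agreement of record** (levels clause): the trace on `Π_v` of any `Π^±_v`-cuspidal group is `Cu`-cuspidal in `Π_v`, so the
`Π_v`-family is inhabited as soon as the `Π^±_v`-family is (which `A.inertia_iff` grants at every cusp of `X̲_v`).  PROVED.
[claim: Mochizuki2012, status: disputed] (IUTchII §2 Def 2.3 (ii), kurims p.68) -/
theorem nonempty_cuspidalInertia_piV_ofPiCHat_of_levels
    (hlev : ∀ Q' I : Subgroup (ofPiCHat e C μ hC hS hl hp2 hpl hζ hη hZ hN T).Corhat,
      Cu.IsCuspidalInertia Q' I ↔ I ≤ Q' ∧ ∃ I₀, Cu.IsCuspidalInertia (ofPiCHat e C μ hC hS hl hp2 hpl hζ hη hZ hN T).piPM I₀ ∧ I = I₀ ⊓ Q')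
    (hex : ∃ I₀, Cu.IsCuspidalInertia (ofPiCHat e C μ hC hS hl hp2 hpl hζ hη hZ hN T).piPM I₀) :
    Nonempty {I // Cu.IsCuspidalInertia (ofPiCHat e C μ hC hS hl hp2 hpl hζ hη hZ hN T).piV I} := by
  obtain ⟨I₀, hI₀⟩ := hex
  exact ⟨⟨_, isCuspidalInertia_piV_inf_of_levels e C μ hC hS hl hp2 hpl hζ hη e.toPiCHat e.isProfiniteCompletion_toPiCHat e.toPiCHat_injective e.piCData.aug.toMonoidHom (fun g => e.piCData_aug_apply g) e.piCData.range_aug hZ hN T Cu hlev hI₀⟩⟩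

/-! ### v2 (append-only): the `Π^±_v`-family of the agreement of record is INHABITED — non-vacuity by name -/

omit Cu A in
/-- The special-fibre datum of `X̲_v` HAS a cusp over every cusp `x₀` of `X` (the point of `X̲_v` with double coset `H · 1 · D_{x₀}`).  PROVED.
[claim: Mochizuki2012, status: disputed] (IUTchI §2, kurims p.47) -/
theorem nonempty_cusp_ofSpecialFibre {x₀ : M.Pt} (hx₀ : M.IsCusp x₀) :
    Nonempty (StableCurveTemperedData.ofSpecialFibre (M.toTemperedCurve.ofOpenSubgroup (M.GtpXu l) (M.toThetaSetting.isOpen_GtpXu l) M.K (range_aug_GtpXu_eq_GK C) hDopen) d Sf h36 Sigma SigmaHat hsub hne hprime hp TpH HatH hle cuspMeetsH).Cusp :=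
  ⟨⟨⟨x₀, DoubleCoset.mk (M.GtpXu l) (M.toTemperedCurve.decomp x₀) 1⟩, hx₀⟩⟩

/-- **On `emb w`, membership in the `s`-conjugate of the special-fibre inertia group `I_y` (read through `plainIso`) and in the member
`toPiCHat(inclX s)·toPiCHat((inclX g_y·inclX I_x·inclX g_y⁻¹) ∩ inclX Π^tp_{X̲})·toPiCHat(inclX s)⁻¹` agree** (`x` the cusp of `X` under `y`,
`g_y := repOfOpen y`) — the bookkeeping core of `members_of_specialFibreAgreement`, stated on its own.  PROVED.
[claim: Mochizuki2012, status: disputed] (IUTchII §2 Def 2.3 (i)(ii), kurims pp.67–68) -/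
theorem plainIso_mem_conj_inertiaTp_iff_emb_mem_cuspFamily (y : (StableCurveTemperedData.ofSpecialFibre (M.toTemperedCurve.ofOpenSubgroup (M.GtpXu l) (M.toThetaSetting.isOpen_GtpXu l) M.K (range_aug_GtpXu_eq_GK C) hDopen) d Sf h36 Sigma SigmaHat hsub hne hprime hp TpH HatH hle cuspMeetsH).Cusp) (s : (StableCurveTemperedData.ofSpecialFibre (M.toTemperedCurve.ofOpenSubgroup (M.GtpXu l) (M.toThetaSetting.isOpen_GtpXu l) M.K (range_aug_GtpXu_eq_GK C) hDopen) d Sf h36 Sigma SigmaHat hsub hne hprime hp TpH HatH hle cuspMeetsH).PiTp) (w : T.Xplain) :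
    T.plainIso w ∈ MulAut.conj s • ((StableCurveTemperedData.ofSpecialFibre (M.toTemperedCurve.ofOpenSubgroup (M.GtpXu l) (M.toThetaSetting.isOpen_GtpXu l) M.K (range_aug_GtpXu_eq_GK C) hDopen) d Sf h36 Sigma SigmaHat hsub hne hprime hp TpH HatH hle cuspMeetsH).inertiaTp y).map (StableCurveTemperedData.ofSpecialFibre (M.toTemperedCurve.ofOpenSubgroup (M.GtpXu l) (M.toThetaSetting.isOpen_GtpXu l) M.K (range_aug_GtpXu_eq_GK C) hDopen) d Sf h36 Sigma SigmaHat hsub hne hprime hp TpH HatH hle cuspMeetsH).DeltaTp.subtype ↔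
      (ofPiCHat e C μ hC hS hl hp2 hpl hζ hη hZ hN T).emb w ∈
        (@MulAut.conj (ofPiCHat e C μ hC hS hl hp2 hpl hζ hη hZ hN T).Corhat _ (e.toPiCHat (M.inclX s.1)) •
          (((MulAut.conj (M.inclX (M.toTemperedCurve.repOfOpen (M.GtpXu l) y.1)) •
              (M.toTemperedCurve.inertia y.1.1).map M.inclX) ⊓ (M.GtpXu l).map M.inclX).map
            e.toPiCHat.toMonoidHom : Subgroup (ofPiCHat e C μ hC hS hl hp2 hpl hζ hη hZ hN T).Corhat)) := by
  refine (mem_conj_inertiaTp_ofSpecialFibre_iff _ d Sf h36 Sigma SigmaHat hsub hne hprime hp TpH HatH hle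
    cuspMeetsH y s (T.plainIso w)).trans ?_
  refine Iff.trans ?_ (mem_cuspFamily_iff_ofCoverModel e.toPiCHat e.toPiCHat_injective y.1.1
    (M.toTemperedCurve.repOfOpen (M.GtpXu l) y.1) (T.plainIso w) s).symm
  rw [TemperedCurve.inertia, Subgroup.mem_inf, TemperedCurve.DeltaTemp, MonoidHom.mem_ker, map_conj_eq_one_iff]
  refine and_congr ?_ ?_
  · exact Iff.trans (M.toTemperedCurve.mem_decompOfOpenAt (M.GtpXu l)) (by rw [inv_inv]; exact Iff.rfl)
  · exact (map_conj_eq_one_iff M.toTemperedCurve.aug.toMonoidHom s.1 (T.plainIso w).1).symm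

include hA in
/-- **The member through a cusp `y` of `X̲_v` (with `t = 1`) IS `Cu`-cuspidal in `Π^±_v`** for the agreement of record — the converse direction of
`members_of_specialFibreAgreement` at `s = 1`, via abc-iut-L6-t19's constructor `map_subgroupOf_pmHat_eq_of_iff`.  PROVED.
[claim: Mochizuki2012, status: disputed] (IUTchII §2 Def 2.3 (i)(ii), kurims pp.67–68) -/
theorem isCuspidalInertia_piPM_cuspFamily_of_specialFibreAgreement (y : (StableCurveTemperedData.ofSpecialFibre (M.toTemperedCurve.ofOpenSubgroup (M.GtpXu l) (M.toThetaSetting.isOpen_GtpXu l) M.K (range_aug_GtpXu_eq_GK C) hDopen) d Sf h36 Sigma SigmaHat hsub hne hprime hp TpH HatH hle cuspMeetsH).Cusp) :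
    Cu.IsCuspidalInertia (ofPiCHat e C μ hC hS hl hp2 hpl hζ hη hZ hN T).piPM
      (@MulAut.conj (ofPiCHat e C μ hC hS hl hp2 hpl hζ hη hZ hN T).Corhat _ (e.toPiCHat (M.inclX (1 : (StableCurveTemperedData.ofSpecialFibre (M.toTemperedCurve.ofOpenSubgroup (M.GtpXu l) (M.toThetaSetting.isOpen_GtpXu l) M.K (range_aug_GtpXu_eq_GK C) hDopen) d Sf h36 Sigma SigmaHat hsub hne hprime hp TpH HatH hle cuspMeetsH).PiTp).1)) •
        (((MulAut.conj (M.inclX (M.toTemperedCurve.repOfOpen (M.GtpXu l) y.1)) •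
            (M.toTemperedCurve.inertia y.1.1).map M.inclX) ⊓ (M.GtpXu l).map M.inclX).map
          e.toPiCHat.toMonoidHom : Subgroup (ofPiCHat e C μ hC hS hl hp2 hpl hζ hη hZ hN T).Corhat)) := by
  have ht : e.toPiCHat (M.inclX (1 : (StableCurveTemperedData.ofSpecialFibre (M.toTemperedCurve.ofOpenSubgroup (M.GtpXu l) (M.toThetaSetting.isOpen_GtpXu l) M.K (range_aug_GtpXu_eq_GK C) hDopen) d Sf h36 Sigma SigmaHat hsub hne hprime hp TpH HatH hle cuspMeetsH).PiTp).1) ∈ (ofPiCHat e C μ hC hS hl hp2 hpl hζ hη hZ hN T).piPM := by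
    have h : e.toPiCHat (M.inclX (1 : (StableCurveTemperedData.ofSpecialFibre (M.toTemperedCurve.ofOpenSubgroup (M.GtpXu l) (M.toThetaSetting.isOpen_GtpXu l) M.K (range_aug_GtpXu_eq_GK C) hDopen) d Sf h36 Sigma SigmaHat hsub hne hprime hp TpH HatH hle cuspMeetsH).PiTp).1) ∈ ((M.GtpXu l).map M.inclX).map e.toPiCHat.toMonoidHom :=
      ⟨M.inclX (1 : (StableCurveTemperedData.ofSpecialFibre (M.toTemperedCurve.ofOpenSubgroup (M.GtpXu l) (M.toThetaSetting.isOpen_GtpXu l) M.K (range_aug_GtpXu_eq_GK C) hDopen) d Sf h36 Sigma SigmaHat hsub hne hprime hp TpH HatH hle cuspMeetsH).PiTp).1, ⟨(1 : (StableCurveTemperedData.ofSpecialFibre (M.toTemperedCurve.ofOpenSubgroup (M.GtpXu l) (M.toThetaSetting.isOpen_GtpXu l) M.K (range_aug_GtpXu_eq_GK C) hDopen) d Sf h36 Sigma SigmaHat hsub hne hprime hp TpH HatH hle cuspMeetsH).PiTp).1, (1 : (StableCurveTemperedData.ofSpecialFibre (M.toTemperedCurve.ofOpenSubgroup (M.GtpXu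 l) (M.toThetaSetting.isOpen_GtpXu l) M.K (range_aug_GtpXu_eq_GK C) hDopen) d Sf h36 Sigma SigmaHat hsub hne hprime hp TpH HatH hle cuspMeetsH).PiTp).2, rfl⟩, rfl⟩
    rw [← piPM_ofCoverModel] at h; exact h
  have hleM : (@MulAut.conj (ofPiCHat e C μ hC hS hl hp2 hpl hζ hη hZ hN T).Corhat _ (e.toPiCHat (M.inclX (1 : (StableCurveTemperedData.ofSpecialFibre (M.toTemperedCurve.ofOpenSubgroup (M.GtpXu l) (M.toThetaSetting.isOpen_GtpXu l) M.K (range_aug_GtpXu_eq_GK C) hDopen) d Sf h36 Sigma SigmaHat hsub hne hprime hp TpH HatH hle cuspMeetsH).PiTp).1)) •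
        (((MulAut.conj (M.inclX (M.toTemperedCurve.repOfOpen (M.GtpXu l) y.1)) •
            (M.toTemperedCurve.inertia y.1.1).map M.inclX) ⊓ (M.GtpXu l).map M.inclX).map
          e.toPiCHat.toMonoidHom : Subgroup (ofPiCHat e C μ hC hS hl hp2 hpl hζ hη hZ hN T).Corhat)) ≤ (ofPiCHat e C μ hC hS hl hp2 hpl hζ hη hZ hN T).piPM :=
    cuspFamily_le_piPM_ofCoverModel e C μ hC hS hl hp2 hpl hζ hη e.toPiCHat e.isProfiniteCompletion_toPiCHat e.toPiCHat_injective e.piCData.aug.toMonoidHom (fun g => e.piCData_aug_apply g) e.piCData.range_aug hZ hN T ⟨⟨y.1.1, y.2⟩, M.inclX (M.toTemperedCurve.repOfOpen (M.GtpXu l) y.1)⟩ ht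
  refine (A.inertia_iff _).mpr ⟨hleM, y, 1, ?_⟩
  exact A.map_subgroupOf_pmHat_eq_of_iff T.plainIso.toMulEquiv.toEquiv hA hleM fun w =>
    (plainIso_mem_conj_inertiaTp_iff_emb_mem_cuspFamily e C μ hC hS hl hp2 hpl hζ hη hZ hN T hDopen d Sf h36 Sigma SigmaHat hsub
      hne hprime hp TpH HatH hle cuspMeetsH y 1 w).symm

include hA in
/-- **Non-vacuity at the agreement of record, by name**: the `Π^±_v`-family of `Cu` is inhabited as soon as `X` has a cusp, hence (levels
clause `hlev`) so is the `Π_v`-family over which the node's typed statement quantifies.  PROVED. [claim: Mochizuki2012, status: disputed]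
(IUTchII §2 Def 2.3 (ii), kurims p.68) -/
theorem nonempty_cuspidalInertia_piV_of_specialFibreAgreement
    (hlev : ∀ Q' I : Subgroup (ofPiCHat e C μ hC hS hl hp2 hpl hζ hη hZ hN T).Corhat,
      Cu.IsCuspidalInertia Q' I ↔ I ≤ Q' ∧ ∃ I₀, Cu.IsCuspidalInertia (ofPiCHat e C μ hC hS hl hp2 hpl hζ hη hZ hN T).piPM I₀ ∧ I = I₀ ⊓ Q')
    {x₀ : M.Pt} (hx₀ : M.IsCusp x₀) :
    Nonempty {I // Cu.IsCuspidalInertia (ofPiCHat e C μ hC hS hl hp2 hpl hζ hη hZ hN T).piV I} := by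
  obtain ⟨y⟩ := nonempty_cusp_ofSpecialFibre C hDopen d Sf h36 Sigma SigmaHat hsub hne hprime hp TpH HatH hle cuspMeetsH hx₀
  exact nonempty_cuspidalInertia_piV_ofPiCHat_of_levels e C μ hC hS hl hp2 hpl hζ hη hZ hN T Cu hlev
    ⟨_, isCuspidalInertia_piPM_cuspFamily_of_specialFibreAgreement e C μ hC hS hl hp2 hpl hζ hη hZ hN T hDopen d Sf h36 Sigma SigmaHat
      hsub hne hprime hp TpH HatH hle cuspMeetsH Cu A hA y⟩

end Agreement

end PlusMinusTower

end Literature.IUT.HodgeArakelov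

end
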